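import Literature.MathematicalPhysics.QuantumFieldTheory.Balaban1983to89.B9Thm311SmallFieldClosed
import Literature.MathematicalPhysics.QuantumFieldTheory.Balaban1983to89.B9Eq319CentreLiftL2

/-!
# `Balaban1983to89.B9Eq368RLipschitzUniform` — T. Bałaban, *Propagators for lattice gauge theories in a background field*, Commun. Math. Phys.
# **99** (1985) 389–434 [Balaban1985BackgroundPropagators] (3.68) p. 403 / (3.76) p. 405, (3.77) p. 406 with Thm 3.4 p. 400: THE pub-balaban NE9 CHAIN'S
# PROJECTION `R(U)` ONTO `Δ_U N(Q′(U))` ((3.21)) IS LIPSCHITZ IN THE BACKGROUND AT THE FLAT POINT WITH `C_R, ε_R` INDEPENDENT OF THE VOLUME —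
# `∃ C_R ε_R > 0` BEFORE `∀ m`: `‖R(U)z − R(1)z‖ ≤ C_R·ε·‖z‖` whenever `‖U(b) − 1‖ ≤ ε ≤ ε_R`, on EVERY periodic lattice `TSite d (L·m)`

statement-level skeleton of published theorems with citation tags; proofs where landed; nothing here is a claim about the Yang–Mills mass gap

PDF held: `paper:balaban1985-cmp99-background-propagators` (journal page = PDF page + 388), pp. 394, 400, 403, 405–406, 416 read by this seat (2026-08-22;
text layer p0006, p0012, p0015, p0017–p0018, p0028).  [v1.1: DOCFIX of this header only (X-readers ne9-leaf-05 g68 C-ne9leaf05g68-2, ne9-leaf-02 g57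
C-ne9leaf02g57-8): the (3.76)–(3.77) quotation is now print's own sentence; every declaration byte-identical to v1 p321300.]

THE PRINT (verbatim).  p. 403: *«the operators R(U), P(U) = I − R(U) extend analytically to the domain (3.37) and satisfy the same bounds»*; p. 405, (3.76):
*«D_{U′U}R(U′U)D*_{U′U} = D_U R(U)D*_U − V₂(A) − … = DRD* − V₂(A) − P₁(A)»* and p. 406: *«where the operator P₁(A) is a non-local operator whose kernel
satisfies the bound (3.77)»* — print carries the `R`-remainder inside this sandwich, not as a display `R(U′U) = R(U) + …` (v1's paraphrase); the phrase
«constant O(1) above depends only on d and L» on p. 406 qualifies the averaging expansions (3.78)–(3.81), not (3.77).  p. 400, Thm 3.4: *«small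
perturbations of the operators depending on U only»*; p. 416, Thm 3.11: *«Under the assumptions of the Theorems 3.1-3.10 (i.e. for M sufficiently large
and α₀ sufficiently small) the operators Δ′_a, G′, (Q′G′_aQ′*)⁻¹, Δ_a, G are positive definite»* (reader's gloss, not print: the smallness `α₀` there is not
a function of the volume).

WHY THIS FILE (cell context).  The NE9 owner's `B9Eq368RLipschitz.exists_RofU_sub_flat_linear` (t4-ne9-p1 gen 81, INTENT-2 A-2) proves the `R`-letter's
Lipschitz bound at a FIXED lattice: its constants `C_R, ε_R` depend on the volume `m` through exactly ONE letter, the sup-to-`L²` norm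
`CS = L^d·√(c₀·#TSite d (L·m))` of the centre lift (`B9Eq384RemainderLetters.norm_centre_le`), used to turn NE9 leaf-03's pointwise `Q′`-closeness into the
`ρ`-slot of `B9Eq368ProjectionRemainder.norm_projR_sub_projR_le`.  NE9 leaf-03's `B9Eq319CentreLiftL2.norm_centreLift_QprimeW_sub_flat_le_linear` measures
`S₀(Q′(U)λ − Q′(1)λ)` — the centre lift OF the difference — DIRECTLY in Hilbert currency with the constant `√(L^d)·d(L−1)·2^{d(L−1)}` (no volume), and this
lineage's `B9Eq323FlatBlockPoincare.flat_modulus_explicit` gives the flat modulus `μ = 2∕(L²η²)` (no volume).  With these two letters the owner's proof runs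
with `∃ C_R ε_R` BEFORE `∀ m` — the same re-plug NE9 leaf-03 performed on the owner's Thm 3.11 chain (`B9Thm311SmallFieldCoercivityUniform`, `C_S := 1`).

WHAT IS PROVED (sorry-free; 0 `def`; no inequality of the paper asserted).
* **`exists_RofU_sub_flat_linear_uniform`** — `∃ C_R ε_R > 0` (numbers of `d, L, η, M_φ, M_φ′` ONLY) such that on EVERY lattice `TSite d (L·m)`, for
  every background `U` with `U(b) ∈ U1`, `‖U(b) − 1‖ ≤ ε ≤ ε_R` and mutually adjoint transporters (`hRS`): `‖R(U)z − R(1)z‖ ≤ C_R·ε·‖z‖` for the chain's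
  `B9Eq326OperatorAssembly.RofU`.  PROOF = the owner's `exists_RofU_sub_flat_linear` VERBATIM (gap-of-subspaces remainder `norm_projR_sub_projR_le` at
  `Δ_i := Δ^η` with `B9Eq373DerivativeRemainderL2`'s letters, common centre right inverse `S₀` by `QprimeW_centre`) with (a) `ρ := √(L^d)·d(L−1)·2^{d(L−1)}·
  K_R·ε` by `norm_centreLift_QprimeW_sub_flat_le_linear` in place of `CS·Cρ·K_R·ε`, (b) `μ := 2∕(L²η²)` by `flat_modulus_explicit`, (c) the bookkeeping
  against `t := ε`.  Explicitly `K_R = 2M_φM_φ′`, `C_ρ = √(L^d)·d(L−1)·2^{d(L−1)}`, `B = μC_ρK_R + 6|η|⁻²dK_R + 16|η|⁻²dC_ρK_R`,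
  `ε_R = min(1∕(K_R+1), μ∕(2B+1))`, `C_R = 4(6|η|⁻²dK_R + 16|η|⁻²dC_ρK_R)∕μ + 1`.
MODEL / DECLARED READINGS.  (M1) one averaging step on `TSite d (L·m)`, weight `c₀`, Hilbert fibre `W` read in `𝔸` by `φ` with `‖φ‖ ≤ M_φ`,
`‖φ⁻¹‖ ≤ M_φ′`; the flat point only.  (M2) no hypothesis of the papers displayed; `U(b) ∈ U1`, `‖U(b) − 1‖ ≤ ε`, `hRS` are the chain's small-field letters.
(M3) NOT HERE: print's analytic remainder `P₁(A)` and its kernel decay (3.77), uniformity in the SPACING `η` or in `L`, two general small fields, `𝔊(U)`.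
HONEST SCOPE.  A restatement of the owner's fixed-lattice letter with ONE input swapped (content: the Lipschitz constant and radius of `R(·)` at the flat point
do not depend on the volume at fixed `L, η`); «NE9 ⇐ the named binders»; NOT summit progress (cell pub-balaban: NE9 NOT PRINTED ∕ NOT PROVED; spine PROVED
0∕9; rung (B)+1 finite T⁴ — NOT infinite volume, NOT mass gap, NOT Clay; HONEST DEPENDENCY: continuum YM on T⁴ ⇐ BetaPertH ∧ nine spine estimates (0/9
proved); BetaPertH ⇐ (D1) ∧ (D4) ∧ CAP+tail; G-an2-4 gates asym, D1 and NE2/3/4).  Unit `b2b-balaban-t4-ne9-formalise-leaf-04` (NE9 crux-team leaf prover,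
gen 71), INTENT I-ne9leaf04-g71-1; the proof text is the OWNER t4-ne9-p1 gen 81's, re-plugged; NEW file importing `B9Thm311SmallFieldClosed` +
`B9Eq319CentreLiftL2`; modifies nothing.  Net new unproved facts: 0.
-/

noncomputable section

open scoped InnerProductSpace ComplexConjugate

namespace Literature.MathematicalPhysics.QuantumFieldTheory.Balaban1983to89.B9Eq368RLipschitzUniform

open B4Sect5Torus (TSite)
open B9SectCLatticeCarrier (Bond)
open B7Prop1Explicit (U1)
open B9Eq311L2Pairing (WL2)
open B9Eq319QprimeTorus (fineP centre weight)
open B9Eq319Onto (centreFun)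
open B11Eq103H1Complex (SiteL2K BondL2K covLaplaceSiteK RLatticeK)
open B9Eq310HessianOperator (adTransportW)
open B9Eq326OperatorAssembly (RofU QprimeW)
open B9Eq368ProjectionRemainder (norm_projR_sub_projR_le)
open B9Eq373DerivativeRemainderL2 (norm_covLaplaceSiteK_sub_le norm_covLaplaceSiteK_le)
open B9Eq384RemainderLetters (adTransportW_one_apply adTransportW_one_inv_apply hRS_one centreFun_add centreFun_smul QprimeW_centre
  norm_adTransportW_sub_le)
open B9Eq323FlatBlockPoincare (flat_modulus_explicit)
open B9Eq319CentreLiftL2 (norm_centreLift_QprimeW_sub_flat_le_linear)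

/-- arithmetic helper: `B·t ≤ μ/2` when `t ≤ μ/(2B + 1)` (as in the owner's file). [folklore] -/
private theorem mul_le_half_of_le_div {B μ t : ℝ} (hB : 0 ≤ B) (hμ : 0 ≤ μ) (ht : t ≤ μ / (2 * B + 1)) : B * t ≤ μ / 2 := by
  have h1 : B * t ≤ B * (μ / (2 * B + 1)) := mul_le_mul_of_nonneg_left ht hB
  have h2 : B * (μ / (2 * B + 1)) ≤ μ / 2 := by
    rw [mul_div_assoc', div_le_div_iff₀ (by positivity) (by norm_num)]; nlinarith
  exact h1.trans h2

variable {d : ℕ} (L : ℕ) [NeZero L]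
  {𝔸 : Type*} [NormedRing 𝔸] [NormedAlgebra ℂ 𝔸] [NormOneClass 𝔸]
  {W : Type*} [NormedAddCommGroup W] [InnerProductSpace ℂ W] [FiniteDimensional ℂ W] (φ : W ≃ₗ[ℂ] 𝔸) {c₀ : ℝ} [Fact (0 < c₀)]

/-- **`R(U)` IS LIPSCHITZ IN THE BACKGROUND AT THE FLAT POINT, WITH `C_R, ε_R` INDEPENDENT OF THE VOLUME**: `∃ C_R ε_R > 0` — numbers of
`d, L, η, M_φ, M_φ′` — such that on EVERY lattice `TSite d (L·m)`, for every `U` with `U(b) ∈ U1`, `‖U(b) − 1‖ ≤ ε ≤ ε_R` and `hRS`: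
`‖R(U)z − R(1)z‖ ≤ C_R·ε·‖z‖`.  The owner's `B9Eq368RLipschitz.exists_RofU_sub_flat_linear` with the volume quantified INSIDE: the `ρ`-slot of
`B9Eq368ProjectionRemainder.norm_projR_sub_projR_le` is fed by NE9 leaf-03's `norm_centreLift_QprimeW_sub_flat_le_linear` (`ρ = √(L^d)·d(L−1)·2^{d(L−1)}·
2M_φM_φ′·ε`, no volume) and the flat modulus by `flat_modulus_explicit` (`μ = 2∕(L²η²)`).
[cite: Balaban1985BackgroundPropagators, (3.68) p.403, (3.76)–(3.77) p.406, (3.21) p.394, Thm 3.11 p.416] -/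
theorem exists_RofU_sub_flat_linear_uniform {η : ℝ} (hη : η ≠ 0) {Mφ Mφ' : ℝ} (hMφ : 0 ≤ Mφ) (hMφ' : 0 ≤ Mφ')
    (hφ : ∀ w, ‖φ w‖ ≤ Mφ * ‖w‖) (hφ' : ∀ X, ‖φ.symm X‖ ≤ Mφ' * ‖X‖) :
    ∃ CR εR₀ : ℝ, 0 < CR ∧ 0 < εR₀ ∧ ∀ (m : Fin d → ℕ) [∀ i, NeZero (fineP L m i)] (U : Bond d (fineP L m) → 𝔸ˣ) {ε : ℝ}, 0 ≤ ε → ε ≤ εR₀ →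
      (∀ b, U b ∈ U1 𝔸) → (∀ b, ‖(U b : 𝔸) - 1‖ ≤ ε) →
      (∀ (b : Bond d (fineP L m)) (v u : W), ⟪adTransportW φ U b v, u⟫_ℂ = ⟪v, adTransportW φ (fun b => (U b)⁻¹) b u⟫_ℂ) →
      ∀ z : SiteL2K ℂ d (fineP L m) c₀ W,
        ‖RofU L m φ η U z - RofU L m φ η (fun _ : Bond d (fineP L m) => (1 : 𝔸ˣ)) z‖ ≤ CR * ε * ‖z‖ := by
  have hc₀ : 0 < c₀ := Fact.out
  have hc : conj ((η : ℂ))⁻¹ = ((η : ℂ))⁻¹ := by rw [map_inv₀, Complex.conj_ofReal]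
  have hL0 : (0 : ℝ) < L := by exact_mod_cast Nat.pos_of_ne_zero (NeZero.ne L)
  have hη2 : 0 < η ^ 2 := lt_of_le_of_ne (sq_nonneg η) (Ne.symm (pow_ne_zero 2 hη))
  -- constants, ALL fixed before the volume: `μ = 2/(L²η²)`, `K_R`, `C_ρ`, `B`, `C_R`
  obtain ⟨μ, hμdef⟩ : ∃ μ : ℝ, μ = 2 / ((L : ℝ) ^ 2 * η ^ 2) := ⟨_, rfl⟩
  have hμ : 0 < μ := by rw [hμdef]; positivity
  obtain ⟨KR, hKRdef⟩ : ∃ KR : ℝ, KR = 2 * Mφ * Mφ' := ⟨_, rfl⟩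
  have hKR : 0 ≤ KR := by rw [hKRdef]; positivity
  obtain ⟨Cρ, hCρdef⟩ : ∃ Cρ : ℝ, Cρ = Real.sqrt ((L : ℝ) ^ d) * ((d * (L - 1) : ℕ) * 2 ^ (d * (L - 1))) := ⟨_, rfl⟩
  have hCρ : 0 ≤ Cρ := by rw [hCρdef]; positivity
  obtain ⟨B, hBdef⟩ : ∃ B : ℝ, B = μ * (Cρ * KR) + 6 * ‖((η : ℂ))⁻¹‖ ^ 2 * d * KR + 16 * ‖((η : ℂ))⁻¹‖ ^ 2 * d * (Cρ * KR) := ⟨_, rfl⟩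
  have hB : 0 ≤ B := by rw [hBdef]; positivity
  obtain ⟨CR, hCRdef⟩ : ∃ CR : ℝ, CR = 4 * (6 * ‖((η : ℂ))⁻¹‖ ^ 2 * d * KR + 16 * ‖((η : ℂ))⁻¹‖ ^ 2 * d * (Cρ * KR)) / μ + 1 := ⟨_, rfl⟩
  have hCR : 0 < CR := by rw [hCRdef]; positivity
  refine ⟨CR, min (1 / (KR + 1)) (μ / (2 * B + 1)), hCR, by positivity, ?_⟩
  intro m _ U ε hε hεR₀ hUb hUε hRS z
  have ht1 : ε ≤ 1 / (KR + 1) := hεR₀.trans (min_le_left _ _)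
  have ht2 : ε ≤ μ / (2 * B + 1) := hεR₀.trans (min_le_right _ _)
  -- the flat modulus at this lattice, by the explicit letter
  have hmod : ∀ l : SiteL2K ℂ d (fineP L m) c₀ W, QprimeW L m φ (fun _ : Bond d (fineP L m) => (1 : 𝔸ˣ)) l = 0 →
      μ * ‖l‖ ≤ ‖covLaplaceSiteK ((η : ℂ))⁻¹ (adTransportW φ (fun _ : Bond d (fineP L m) => (1 : 𝔸ˣ)))
        (adTransportW φ fun _ : Bond d (fineP L m) => (1 : 𝔸ˣ)⁻¹) l‖ := fun l hl => by
    rw [hμdef]; exact flat_modulus_explicit L m φ hη l hl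
  -- the transporters
  obtain ⟨εR, hεRdef⟩ : ∃ εR : ℝ, εR = KR * ε := ⟨_, rfl⟩
  have hεR : 0 ≤ εR := by rw [hεRdef]; positivity
  have hεR1 : εR ≤ 1 := by
    rw [hεRdef]
    refine (mul_le_mul_of_nonneg_left ht1 hKR).trans ?_
    rw [mul_one_div, div_le_one (by positivity)]; linarith
  have hR : ∀ (b : Bond d (fineP L m)) (w : W), ‖adTransportW φ U b w - w‖ ≤ εR * ‖w‖ := fun b w => by
    have h := norm_adTransportW_sub_le φ hφ hφ' hMφ' U b (hUb b) (hUε b) w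
    rw [hεRdef, hKRdef]; linarith
  have hR₁ : ∀ (b : Bond d (fineP L m)) (w : W), adTransportW φ (fun _ : Bond d (fineP L m) => (1 : 𝔸ˣ)) b w = w :=
    adTransportW_one_apply L m φ
  have hS₁ : ∀ (b : Bond d (fineP L m)) (w : W), adTransportW φ (fun _ : Bond d (fineP L m) => (1 : 𝔸ˣ)⁻¹) b w = w :=
    adTransportW_one_inv_apply L m φ
  have hR₁ε : ∀ (b : Bond d (fineP L m)) (w : W), ‖adTransportW φ (fun _ : Bond d (fineP L m) => (1 : 𝔸ˣ)) b w - w‖ ≤ εR * ‖w‖ :=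
    fun b w => by rw [hR₁, sub_self, norm_zero]; positivity
  have hRS₁ := hRS_one L m φ (𝔸 := 𝔸)
  -- the centre lift as a linear map: a right inverse of `Q′(V)` for EVERY `V`
  let S₀ : (TSite d m → W) →ₗ[ℂ] SiteL2K ℂ d (fineP L m) c₀ W :=
    { toFun := fun ω => (WL2.equiv ℂ (fun _ : TSite d (fineP L m) => c₀) W).symm (centreFun (weight L m) (centre L m) ω)
      map_add' := fun ω ω' => by rw [centreFun_add]; rfl
      map_smul' := fun r ω => by rw [centreFun_smul]; rfl }
  have hS₀ : ∀ (V : Bond d (fineP L m) → 𝔸ˣ) (f : TSite d m → W), QprimeW L m φ V (c₀ := c₀) (S₀ f) = f :=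
    fun V f => QprimeW_centre L m φ V f
  -- (ρ) VOLUME-FREE, by NE9 leaf-03's centre-lift letter: `ρ = C_ρ·K_R·ε`
  obtain ⟨ρ, hρdef⟩ : ∃ ρ : ℝ, ρ = Cρ * (KR * ε) := ⟨_, rfl⟩
  have hρ0 : 0 ≤ ρ := by rw [hρdef]; positivity
  have hρ : ∀ l : SiteL2K ℂ d (fineP L m) c₀ W,
      ‖S₀ (QprimeW L m φ U l - QprimeW L m φ (fun _ : Bond d (fineP L m) => (1 : 𝔸ˣ)) l)‖ ≤ ρ * ‖l‖ := fun l => by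
    have h := norm_centreLift_QprimeW_sub_flat_le_linear L m φ U (c₀ := c₀) hεR hεR1 hR l
    rw [hρdef, hCρdef, hεRdef] at *
    calc ‖S₀ (QprimeW L m φ U l - QprimeW L m φ (fun _ : Bond d (fineP L m) => (1 : 𝔸ˣ)) l)‖
        = ‖(WL2.equiv ℂ (fun _ : TSite d (fineP L m) => c₀) W).symm (centreFun (weight L m) (centre L m)
            (QprimeW L m φ U (c₀ := c₀) l - QprimeW L m φ (fun _ : Bond d (fineP L m) => (1 : 𝔸ˣ)) (c₀ := c₀) l))‖ := rfl
      _ ≤ Real.sqrt ((L : ℝ) ^ d) * ((d * (L - 1) : ℕ) * 2 ^ (d * (L - 1))) * (KR * ε) * ‖l‖ := h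
      _ = Real.sqrt ((L : ℝ) ^ d) * ((d * (L - 1) : ℕ) * 2 ^ (d * (L - 1))) * (KR * ε) * ‖l‖ := rfl
  -- smallness bookkeeping against `ε`
  have hεΔ : 2 * (2 + εR) * ‖((η : ℂ))⁻¹‖ ^ 2 * d * εR ≤ 6 * ‖((η : ℂ))⁻¹‖ ^ 2 * d * KR * ε := by
    have h1 : 2 * (2 + εR) ≤ 6 := by linarith
    calc 2 * (2 + εR) * ‖((η : ℂ))⁻¹‖ ^ 2 * d * εR = (2 * (2 + εR)) * (‖((η : ℂ))⁻¹‖ ^ 2 * d * εR) := by ring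
      _ ≤ 6 * (‖((η : ℂ))⁻¹‖ ^ 2 * d * (KR * ε)) :=
          mul_le_mul h1 (by rw [hεRdef]) (by positivity) (by norm_num)
      _ = 6 * ‖((η : ℂ))⁻¹‖ ^ 2 * d * KR * ε := by ring
  have hM16 : 4 * (1 + εR) ^ 2 * ‖((η : ℂ))⁻¹‖ ^ 2 * d ≤ 16 * ‖((η : ℂ))⁻¹‖ ^ 2 * d := by
    have h1 : (1 + εR) ^ 2 ≤ 4 := by
      calc (1 + εR) ^ 2 ≤ 2 ^ 2 := pow_le_pow_left₀ (by positivity) (by linarith) 2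
        _ = 4 := by norm_num
    calc 4 * (1 + εR) ^ 2 * ‖((η : ℂ))⁻¹‖ ^ 2 * d = (1 + εR) ^ 2 * (4 * ‖((η : ℂ))⁻¹‖ ^ 2 * d) := by ring
      _ ≤ 4 * (4 * ‖((η : ℂ))⁻¹‖ ^ 2 * d) := mul_le_mul_of_nonneg_right h1 (by positivity)
      _ = 16 * ‖((η : ℂ))⁻¹‖ ^ 2 * d := by ring
  have hMρ : 4 * (1 + εR) ^ 2 * ‖((η : ℂ))⁻¹‖ ^ 2 * d * ρ ≤ 16 * ‖((η : ℂ))⁻¹‖ ^ 2 * d * (Cρ * KR) * ε :=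
    calc 4 * (1 + εR) ^ 2 * ‖((η : ℂ))⁻¹‖ ^ 2 * d * ρ ≤ 16 * ‖((η : ℂ))⁻¹‖ ^ 2 * d * ρ := mul_le_mul_of_nonneg_right hM16 hρ0
      _ = 16 * ‖((η : ℂ))⁻¹‖ ^ 2 * d * (Cρ * KR) * ε := by rw [hρdef]; ring
  have hμρ : μ * ρ = μ * (Cρ * KR) * ε := by rw [hρdef]; ring
  have hBt : B * ε ≤ μ / 2 := mul_le_half_of_le_div hB hμ.le ht2
  have hsum : μ * ρ + (2 * (2 + εR) * ‖((η : ℂ))⁻¹‖ ^ 2 * d * εR + 4 * (1 + εR) ^ 2 * ‖((η : ℂ))⁻¹‖ ^ 2 * d * ρ) ≤ μ / 2 := by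
    have : μ * (Cρ * KR) * ε + (6 * ‖((η : ℂ))⁻¹‖ ^ 2 * d * KR * ε + 16 * ‖((η : ℂ))⁻¹‖ ^ 2 * d * (Cρ * KR) * ε) = B * ε := by
      rw [hBdef]; ring
    linarith [hμρ, hεΔ, hMρ]
  have hrew : μ * (1 - ρ) - (2 * (2 + εR) * ‖((η : ℂ))⁻¹‖ ^ 2 * d * εR + 4 * (1 + εR) ^ 2 * ‖((η : ℂ))⁻¹‖ ^ 2 * d * ρ) =
      μ - (μ * ρ + (2 * (2 + εR) * ‖((η : ℂ))⁻¹‖ ^ 2 * d * εR + 4 * (1 + εR) ^ 2 * ‖((η : ℂ))⁻¹‖ ^ 2 * d * ρ)) := by ring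
  have hν2 : μ / 2 ≤ μ * (1 - ρ) - (2 * (2 + εR) * ‖((η : ℂ))⁻¹‖ ^ 2 * d * εR + 4 * (1 + εR) ^ 2 * ‖((η : ℂ))⁻¹‖ ^ 2 * d * ρ) := by
    rw [hrew]; linarith
  have hν : 0 < μ * (1 - ρ) - (2 * (2 + εR) * ‖((η : ℂ))⁻¹‖ ^ 2 * d * εR + 4 * (1 + εR) ^ 2 * ‖((η : ℂ))⁻¹‖ ^ 2 * d * ρ) :=
    lt_of_lt_of_le (by positivity) hν2
  -- the gap-of-subspaces remainder (the owner's `hRdiff` step, verbatim)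
  have hM : 0 ≤ 4 * (1 + εR) ^ 2 * ‖((η : ℂ))⁻¹‖ ^ 2 * d := by positivity
  have hεp : 0 ≤ 2 * (2 + εR) * ‖((η : ℂ))⁻¹‖ ^ 2 * d * εR := by positivity
  have hRdiff : ‖RofU L m φ η U z - RofU L m φ η (fun _ => 1) z‖ ≤
      2 * (2 * (2 + εR) * ‖((η : ℂ))⁻¹‖ ^ 2 * d * εR + 4 * (1 + εR) ^ 2 * ‖((η : ℂ))⁻¹‖ ^ 2 * d * ρ) /
        (μ * (1 - ρ) - (2 * (2 + εR) * ‖((η : ℂ))⁻¹‖ ^ 2 * d * εR + 4 * (1 + εR) ^ 2 * ‖((η : ℂ))⁻¹‖ ^ 2 * d * ρ)) * ‖z‖ := by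
    rw [norm_sub_rev]
    unfold RofU RLatticeK
    exact norm_projR_sub_projR_le _ _ _ _ S₀ S₀ (hS₀ _) (hS₀ _) hμ hM hεp hρ0 hmod
      (norm_covLaplaceSiteK_le _ hc hεR hR₁ε hRS₁) (norm_covLaplaceSiteK_le _ hc hεR hR hRS)
      (norm_covLaplaceSiteK_sub_le _ hc hεR hR hR₁ hRS hS₁) hρ
      (fun l => by
        have h : S₀ (QprimeW L m φ (fun _ : Bond d (fineP L m) => (1 : 𝔸ˣ)) l - QprimeW L m φ U l) =
            -S₀ (QprimeW L m φ U l - QprimeW L m φ (fun _ : Bond d (fineP L m) => (1 : 𝔸ˣ)) l) := by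
          rw [← map_neg, neg_sub]
        rw [h, norm_neg]; exact hρ l)
      hν z
  -- the constant, linear in `ε`
  have hδR : 2 * (2 * (2 + εR) * ‖((η : ℂ))⁻¹‖ ^ 2 * d * εR + 4 * (1 + εR) ^ 2 * ‖((η : ℂ))⁻¹‖ ^ 2 * d * ρ) /
      (μ * (1 - ρ) - (2 * (2 + εR) * ‖((η : ℂ))⁻¹‖ ^ 2 * d * εR + 4 * (1 + εR) ^ 2 * ‖((η : ℂ))⁻¹‖ ^ 2 * d * ρ)) ≤
      4 * (6 * ‖((η : ℂ))⁻¹‖ ^ 2 * d * KR + 16 * ‖((η : ℂ))⁻¹‖ ^ 2 * d * (Cρ * KR)) * ε / μ := by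
    have hnum : 0 ≤ 2 * (2 * (2 + εR) * ‖((η : ℂ))⁻¹‖ ^ 2 * d * εR + 4 * (1 + εR) ^ 2 * ‖((η : ℂ))⁻¹‖ ^ 2 * d * ρ) := by positivity
    calc _ ≤ 2 * (2 * (2 + εR) * ‖((η : ℂ))⁻¹‖ ^ 2 * d * εR + 4 * (1 + εR) ^ 2 * ‖((η : ℂ))⁻¹‖ ^ 2 * d * ρ) / (μ / 2) :=
          div_le_div_of_nonneg_left hnum (by positivity) hν2
      _ = 4 * (2 * (2 + εR) * ‖((η : ℂ))⁻¹‖ ^ 2 * d * εR + 4 * (1 + εR) ^ 2 * ‖((η : ℂ))⁻¹‖ ^ 2 * d * ρ) / μ := by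
          field_simp; ring
      _ ≤ 4 * (6 * ‖((η : ℂ))⁻¹‖ ^ 2 * d * KR * ε + 16 * ‖((η : ℂ))⁻¹‖ ^ 2 * d * (Cρ * KR) * ε) / μ := by
          gcongr
      _ = 4 * (6 * ‖((η : ℂ))⁻¹‖ ^ 2 * d * KR + 16 * ‖((η : ℂ))⁻¹‖ ^ 2 * d * (Cρ * KR)) * ε / μ := by ring
  refine hRdiff.trans (mul_le_mul_of_nonneg_right (hδR.trans ?_) (norm_nonneg _))
  have hslack : 0 ≤ 1 * ε := by positivity
  have hring : 4 * (6 * ‖((η : ℂ))⁻¹‖ ^ 2 * d * KR + 16 * ‖((η : ℂ))⁻¹‖ ^ 2 * d * (Cρ * KR)) * ε / μ + 1 * ε = CR * ε := by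
    rw [hCRdef]; ring
  exact (le_add_of_nonneg_right hslack).trans hring.le

end Literature.MathematicalPhysics.QuantumFieldTheory.Balaban1983to89.B9Eq368RLipschitzUniform

end
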